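import Summits.ValiantsHypothesis.ValiantsHypothesis.Theorems.LacunarySymmetroidMatrixDescartesCensusDoorA34SheetHyperbolicPencil
import Summits.ValiantsHypothesis.ValiantsHypothesis.Theorems.LacunarySymmetroidMatrixDescartesCensusDoorA34NullTopBlocks

/-!
# `MatrixDescartes` census — DOOR A at `(3,4)`: the BLOCKS of a null-top pencil with a hyperbolic top letter, as polynomials —
# `det F = det G + X^{d₃}·C(2h)·(vᵀ adj G w) − X^{2d₃}·C(h²)·(kᵀ G k)`, the middle block on the pair sums (`≤ 5` positive roots), the top block a
# trinomial (`≤ 2` positive roots)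

HONEST FRAMING.  Object-search cell `pub-symmetroid`, engine seat `val-sym-eng-2` (g7); helper row beside the registered strata line
`Cruxes/DoorA34/Lines/strata.lean` on stmt-ValiantsHypothesis-19980 (`DoorA34 = PosRootLawAt 3 4 18`: OPEN, typed, never asserted here), stub
`stub_nullTopCeiling`, INDEFINITE cell.  The polynomial-level twin of …SheetHyperbolicPencil: for the `(3,4)` pencil `F = Σ_l X^{d_l}·S_l` with top letter
`S₃ = h·(vwᵀ + wvᵀ)` and core `G = Σ_{l<3} X^{d_l}·S_l` (over `ℝ[X]`, `v̂ = C ∘ v`, `ŵ = C ∘ w`, `k = v × w`):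

* `map_C_hyperbolic`, `cross_map_C` — bookkeeping (`(h·(vwᵀ+wvᵀ)).map C = C h·(v̂ŵᵀ + ŵv̂ᵀ)`, `v̂ × ŵ = C ∘ (v × w)`);
* `isSymm_pencil_poly` — a pencil with symmetric letters is a symmetric polynomial matrix;
* `det_pencil_hyperbolicTop_eq_blocks` — **HYPERBOLIC BLOCK ANATOMY**: `det F = det G + X^{d₃}·(C(2h)·v̂ᵀ adj(G) ŵ) − (X^{d₃})²·(C(h²)·k̂ᵀ G k̂)` (symmetric
  letters) — …NullTopBlocks' `tr(adj G·S₃)` and `tr(adj S₃·G)` made explicit for the indefinite cell: MIDDLE block `= 2h ×` the bilinear adjugate form,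
  TOP block `= −h² ×` the line compression at the kernel vector;
* `bilin_pencil_eq_sum` — `âᵀ (Σ X^{d_l} S_l) b̂ = Σ_l C(aᵀS_l b)·X^{d_l}` (any `K`): the top block is the TRINOMIAL `Σ_{l<3} C(kᵀS_lk)·X^{d_l}`;
* `support_topBlock_subset`, `card_posRoots_topBlock_le_two` — the top block lives on `{d₀,d₁,d₂}`, so it has `≤ 2` positive roots (or vanishes);
* `support_middleBlock_subset`, `card_posRoots_middleBlock_le_five` — the middle block lives on the `≤ 6` pair sums, so it has `≤ 5` positive roots (or
  vanishes) — the Descartes budgets `γ_M ≤ 5`, `γ_T ≤ 2` of the window accounting `9 + j₁ + γ_M + j₂ + γ_T` used by the seat reports (HOME/DOOR-A34-ENG2G6/G7-REPORT.md).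

Nothing here bounds the count of `det F`; `DoorA34` and the three stubs stay OPEN; registers unchanged; nothing on `MatrixDescartes` (stmt-ValiantsHypothesis-18050)
or `VP ≠ VNP` — VP≠VNP not moved.  [folklore] block expansion + sparse Descartes (`Literature…card_roots_toFinset_filter_pos_lt_card_support`); elementary.
-/

-- `Summit.ValiantsHypothesis.ValiantsHypothesis.…` repeats a component by the D-0017 layout
-- (single-conjunct summit), which the `dupNamespace` linter flags; the name is mandated.
set_option linter.dupNamespace false

namespace Summit.ValiantsHypothesis.ValiantsHypothesis.Theorems.LacunarySymmetroidMatrixDescartes.Census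

open Polynomial Finset
open scoped BigOperators Polynomial Matrix
open Matrix

/-! ## 1. Bookkeeping under `map C` -/

/-- `(h·(vwᵀ + wvᵀ)).map C = C h • ((C∘v)(C∘w)ᵀ + (C∘w)(C∘v)ᵀ)`. [folklore] -/
theorem map_C_hyperbolic (h : ℝ) (v w : Fin 3 → ℝ) :
    (h • (Matrix.vecMulVec v w + Matrix.vecMulVec w v)).map (C : ℝ → ℝ[X])
      = C h • (Matrix.vecMulVec (fun i => C (v i)) (fun i => C (w i)) + Matrix.vecMulVec (fun i => C (w i)) (fun i => C (v i))) := by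
  ext i j
  simp only [Matrix.map_apply, Matrix.smul_apply, Matrix.add_apply, Matrix.vecMulVec_apply, smul_eq_mul, map_mul, map_add]

/-- The cross product commutes with `C`: `(C∘v) × (C∘w) = C ∘ (v × w)`. [folklore] -/
theorem cross_map_C (v w : Fin 3 → ℝ) :
    (fun i => C (v i)) ⨯₃ (fun i => C (w i)) = fun i => (C ((v ⨯₃ w) i) : ℝ[X]) := by
  ext i
  fin_cases i <;> simp [cross_apply]

/-- A pencil with symmetric letters is a symmetric polynomial matrix. [folklore] -/
theorem isSymm_pencil_poly {K m : ℕ} (d : Fin K → ℕ) {S : Fin K → Matrix (Fin m) (Fin m) ℝ} (hS : ∀ l, (S l).IsSymm) :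
    (∑ l, ((X : ℝ[X]) ^ d l) • (S l).map C).IsSymm := by
  unfold Matrix.IsSymm
  rw [Matrix.transpose_sum]
  refine Finset.sum_congr rfl fun l _ => ?_
  rw [Matrix.transpose_smul, ← Matrix.transpose_map, (hS l).eq]

/-! ## 2. The hyperbolic block anatomy -/

/-- **HYPERBOLIC BLOCK ANATOMY** of the `(3,4)` pencil with symmetric letters and top letter `h·(vwᵀ + wvᵀ)`:
`det F = det G + X^{d₃}·(C(2h)·v̂ᵀ adj(G) ŵ) − (X^{d₃})²·(C(h²)·k̂ᵀ G k̂)`, `G` the core, `k = v × w`. [folklore] -/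
theorem det_pencil_hyperbolicTop_eq_blocks (d : Fin 4 → ℕ) (S : Fin 4 → Matrix (Fin 3) (Fin 3) ℝ) (hS : ∀ l, (S l).IsSymm) (h : ℝ)
    (v w : Fin 3 → ℝ) (hS3 : S 3 = h • (Matrix.vecMulVec v w + Matrix.vecMulVec w v)) :
    (∑ l, ((X : ℝ[X]) ^ d l) • (S l).map C).det
      = (∑ l : Fin 3, ((X : ℝ[X]) ^ d (Fin.castSucc l)) • (S (Fin.castSucc l)).map C).det
        + (X : ℝ[X]) ^ d 3 * (C (2 * h) * ((fun i => C (v i)) ⬝ᵥ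
            ((∑ l : Fin 3, ((X : ℝ[X]) ^ d (Fin.castSucc l)) • (S (Fin.castSucc l)).map C).adjugate *ᵥ fun i => C (w i))))
        - ((X : ℝ[X]) ^ d 3) ^ 2 * (C (h ^ 2) * ((fun i => C ((v ⨯₃ w) i)) ⬝ᵥ
            ((∑ l : Fin 3, ((X : ℝ[X]) ^ d (Fin.castSucc l)) • (S (Fin.castSucc l)).map C) *ᵥ fun i => C ((v ⨯₃ w) i)))) := by
  have hcore : (∑ l : Fin 3, ((X : ℝ[X]) ^ d (Fin.castSucc l)) • (S (Fin.castSucc l)).map C).IsSymm :=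
    isSymm_pencil_poly (fun l : Fin 3 => d (Fin.castSucc l)) (fun l => hS (Fin.castSucc l))
  rw [pencil_eq_core_add_top, hS3, map_C_hyperbolic, smul_smul, det_add_smul_hyperbolic_fin_three, cross_map_C,
    ← adjugate_bilin_symm _ hcore]
  simp only [map_mul, map_pow, C_ofNat]
  ring

/-! ## 3. The top block is a trinomial, the middle block lives on the pair sums -/

/-- A bilinear form of the pencil expands letterwise: `âᵀ (Σ_l X^{d_l} S_l) b̂ = Σ_l C(aᵀ S_l b)·X^{d_l}` (any number of letters). [folklore] -/
theorem bilin_pencil_eq_sum {K : ℕ} (d : Fin K → ℕ) (S : Fin K → Matrix (Fin 3) (Fin 3) ℝ) (a b : Fin 3 → ℝ) :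
    ((fun i => C (a i)) ⬝ᵥ ((∑ l, ((X : ℝ[X]) ^ d l) • (S l).map C) *ᵥ fun i => C (b i)))
      = ∑ l, C (a ⬝ᵥ (S l *ᵥ b)) * (X : ℝ[X]) ^ d l := by
  simp only [dotProduct, Matrix.mulVec, Fin.sum_univ_three, Matrix.sum_apply, Matrix.smul_apply, Matrix.map_apply, smul_eq_mul, map_add,
    map_mul]
  simp only [Finset.mul_sum, Finset.sum_mul, ← Finset.sum_add_distrib]
  exact Finset.sum_congr rfl fun l _ => by ring

/-- The top block `k̂ᵀ G k̂` of the core is supported on `{d₀, d₁, d₂}`. [folklore] -/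
theorem support_topBlock_subset (d : Fin 4 → ℕ) (S : Fin 4 → Matrix (Fin 3) (Fin 3) ℝ) (k : Fin 3 → ℝ) :
    ((fun i => C (k i)) ⬝ᵥ ((∑ l : Fin 3, ((X : ℝ[X]) ^ d (Fin.castSucc l)) • (S (Fin.castSucc l)).map C) *ᵥ fun i => C (k i))).support
      ⊆ (Finset.univ : Finset (Fin 3)).image (fun l => d (Fin.castSucc l)) := by
  rw [bilin_pencil_eq_sum]
  intro n hn
  rw [Polynomial.mem_support_iff, Polynomial.finsetSum_coeff] at hn
  by_contra hni
  apply hn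
  refine Finset.sum_eq_zero fun l _ => ?_
  rw [Polynomial.coeff_C_mul, Polynomial.coeff_X_pow]
  have : n ≠ d (Fin.castSucc l) := fun h => hni (Finset.mem_image.mpr ⟨l, Finset.mem_univ _, h.symm⟩)
  simp [this]

/-- **TOP WINDOW `≤ 2`**: the top block has at most two positive roots (when it is not the zero polynomial). [folklore] -/
theorem card_posRoots_topBlock_le_two (d : Fin 4 → ℕ) (S : Fin 4 → Matrix (Fin 3) (Fin 3) ℝ) (k : Fin 3 → ℝ)
    (h0 : ((fun i => C (k i)) ⬝ᵥ ((∑ l : Fin 3, ((X : ℝ[X]) ^ d (Fin.castSucc l)) • (S (Fin.castSucc l)).map C) *ᵥ fun i => C (k i))) ≠ 0) :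
    (((fun i => C (k i)) ⬝ᵥ ((∑ l : Fin 3, ((X : ℝ[X]) ^ d (Fin.castSucc l)) • (S (Fin.castSucc l)).map C) *ᵥ fun i => C (k i))).roots.toFinset.filter
        (fun t => 0 < t)).card ≤ 2 := by
  have h1 := Literature.Computability.AlgebraicComplexity.card_roots_toFinset_filter_pos_lt_card_support h0
  have h2 : ((fun i => C (k i)) ⬝ᵥ ((∑ l : Fin 3, ((X : ℝ[X]) ^ d (Fin.castSucc l)) • (S (Fin.castSucc l)).map C) *ᵥ fun i => C (k i))).support.card
      ≤ 3 :=
    (Finset.card_le_card (support_topBlock_subset d S k)).trans (Finset.card_image_le.trans (by simp))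
  omega

/-- The middle block `v̂ᵀ adj(G) ŵ` of the core is supported on the pair sums of `d₀, d₁, d₂`. [folklore] -/
theorem support_middleBlock_subset (d : Fin 4 → ℕ) (S : Fin 4 → Matrix (Fin 3) (Fin 3) ℝ) (v w : Fin 3 → ℝ) :
    ((fun i => C (v i)) ⬝ᵥ ((∑ l : Fin 3, ((X : ℝ[X]) ^ d (Fin.castSucc l)) • (S (Fin.castSucc l)).map C).adjugate *ᵥ fun i => C (w i))).support
      ⊆ (Finset.univ : Finset (Fin 2 → Fin 3)).image (fun f => ∑ i, d (Fin.castSucc (f i))) := by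
  intro n hn
  by_contra hni
  apply (Polynomial.mem_support_iff.mp hn)
  simp only [dotProduct, Matrix.mulVec]
  rw [Polynomial.finsetSum_coeff]
  refine Finset.sum_eq_zero fun i _ => ?_
  rw [Polynomial.coeff_C_mul, Polynomial.finsetSum_coeff]
  have : ∀ j : Fin 3, (((∑ l : Fin 3, ((X : ℝ[X]) ^ d (Fin.castSucc l)) • (S (Fin.castSucc l)).map C).adjugate i j) * C (w j)).coeff n = 0 := by
    intro j
    rw [Polynomial.coeff_mul_C]
    have h0 : ((∑ l : Fin 3, ((X : ℝ[X]) ^ d (Fin.castSucc l)) • (S (Fin.castSucc l)).map C).adjugate i j).coeff n = 0 :=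
      Polynomial.notMem_support_iff.mp fun h =>
        hni (support_adjugate_pencil_apply_subset' (fun l : Fin 3 => d (Fin.castSucc l)) (fun l => S (Fin.castSucc l)) i j h)
    rw [h0, zero_mul]
  rw [Finset.sum_eq_zero fun j _ => this j, mul_zero]

/-- **MIDDLE WINDOW `≤ 5`**: the middle block has at most five positive roots (when it is not the zero polynomial). [folklore] -/
theorem card_posRoots_middleBlock_le_five (d : Fin 4 → ℕ) (S : Fin 4 → Matrix (Fin 3) (Fin 3) ℝ) (v w : Fin 3 → ℝ)
    (h0 : ((fun i => C (v i)) ⬝ᵥ ((∑ l : Fin 3, ((X : ℝ[X]) ^ d (Fin.castSucc l)) • (S (Fin.castSucc l)).map C).adjugate *ᵥ fun i => C (w i))) ≠ 0) :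
    (((fun i => C (v i)) ⬝ᵥ ((∑ l : Fin 3, ((X : ℝ[X]) ^ d (Fin.castSucc l)) • (S (Fin.castSucc l)).map C).adjugate *ᵥ fun i => C (w i))).roots.toFinset.filter
        (fun t => 0 < t)).card ≤ 5 := by
  have h1 := Literature.Computability.AlgebraicComplexity.card_roots_toFinset_filter_pos_lt_card_support h0
  have h2 : ((fun i => C (v i)) ⬝ᵥ ((∑ l : Fin 3, ((X : ℝ[X]) ^ d (Fin.castSucc l)) • (S (Fin.castSucc l)).map C).adjugate *ᵥ fun i => C (w i))).support.card
      ≤ 6 :=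
    (Finset.card_le_card (support_middleBlock_subset d S v w)).trans (card_pairSums_three_le (fun l : Fin 3 => d (Fin.castSucc l)))
  omega

end Summit.ValiantsHypothesis.ValiantsHypothesis.Theorems.LacunarySymmetroidMatrixDescartes.Census
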